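import Summits.KontsevichZagierPeriods.Zeta5Search.TwoTaleOmega.FormalBarnesLink
import Summits.KontsevichZagierPeriods.Zeta5Search.TwoTaleOmega.FormalBarnesRes
import Summits.KontsevichZagierPeriods.Zeta5Search.TwoTaleOmega.FormalBarnesT
import Summits.KontsevichZagierPeriods.Zeta5Search.TwoTaleOmega.PFOfFrac
import Literature.NumberTheory.Irrationality.Zudilin2014.FirstTaleNewton
import Literature.NumberTheory.Irrationality.Zudilin2014.FirstTaleScaling

/-!
# (bmiss)@Ω — instance kit A: balance-free first-tale data, closed-form residues, block algebra, telescoping assembly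
(cell `pub-zeta5`, cert-1 gen 4)

HONEST FRAMING: systematic search; recurrence certificates; no irrationality claim unless certified. Pure finite algebra
over `ℚ`/`ℤ`; no named fact.

OUR infrastructure (Summit side) shared by the per-direction instances of the Ω-recurrence (blueprint
`families/tele/RECURRENCE.md` §13.10–13.12; fam-tele's kit `FormalBarnes*`):
* the partial-fraction theorem of the first tale and the degree bound `deg P ≤ d⁺` from WEAK admissibility `AdmissibleW`
  (eq. (cond1) of [Zudilin 2014, §3] WITHOUT the balance `d ≥ 0`, which fails at the points of fam-tele's region Ω with
  `d ∈ {−2,−1}`): `R_eq_polyP_add_polar_w`, `natDegree_polyP_le_w`, `dataR_eval_w` — the tree proofs of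
  `FirstTaleScaling`/`FirstTaleNewton` verbatim, they never used the balance;
* linear (omega-ready) facts about the second smallest of four integers (`a2star_ge_min3`, `a2star_le_others`);
* Lemma U as an EQUALITY of data (`PF.eq_of_eval_eq_on`) and the residues of CLOSED-FORM data `PF.ofFrac N S m`
  (`PFOfFrac`): `PF.rho0_ofFrac_eq_zero` (fam-tele's residue criterion `PF.rho0_eq_zero_of_sq_mul` with the quotient data
  `ofFrac (N /ₘ (X+c)²) S m`: double zero of `N` off `S` ⇒ `ρ⁰ = 0`), `PF.rho1_ofFrac_eq_zero`, `PF.eval_ofFrac_eq_zero_of_dvd`,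
  `altRes1_ofFrac_eq_zero`;
* block algebra: `lin_dvd_block`, `block_single`, `block_succ_left`, `denom_Ico_one`;
* the FIELD ASSEMBLY `telescope_assembly` of a cert lane's cleared identity (`Certificates/TwoTaleTelescope*`) with the
  Γ-ratio facts into the function identity `Σ c_k F_k = Cert(t+1)F₀(t+1) − Cert(t)F₀(t)`.
-/

noncomputable section

open Finset Polynomial
open Literature.NumberTheory.Irrationality.Zudilin2014
open Summit.KontsevichZagierPeriods.Zeta5Search.FormalBarnes

/-! ### First tale without the balance condition -/

namespace Summit.KontsevichZagierPeriods.Zeta5Search.TwoTaleOmega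

/-- **Weak admissibility**: eq. (cond1) of [Zudilin 2014, §3] without `d ≥ 0` — `b_j ≤ a_i` (`j ≤ 3`), `a_i < b₄`. -/
structure AdmissibleW (a b : Fin 4 → ℤ) : Prop where
  /-- `b_j ≤ a_i` for `j ≠ 3` and all `i`. -/
  lower : ∀ j : Fin 4, j ≠ 3 → ∀ i : Fin 4, b j ≤ a i
  /-- `a_i < b₄`. -/
  upper : ∀ i : Fin 4, a i < b 3

/-- Admissible parameters are weakly admissible. -/
theorem admissibleW_of_admissible {a b : Fin 4 → ℤ} (h : Admissible a b) : AdmissibleW a b := ⟨h.lower, h.upper⟩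

variable {a b : Fin 4 → ℤ}

/-- Eq. (P1) on the full pole range, balance-free (proof = `R_eq_polyP_add_polar_full`). -/
theorem R_eq_polyP_add_polar_full_w (h : AdmissibleW a b) {t : ℚ} (ht : ∀ k ∈ Ico (a 3) (b 3), t + k ≠ 0) :
    R a b t = (polyP a b).eval t + ∑ k ∈ Ico (a 3) (b 3), coefC a b k / (t + k) := by
  have hIco : Ico (a 3) (b 3) = Ico (a 3) (a 3 + ((b 3 - a 3 - 1).toNat : ℕ) + 1) := by
    have := h.upper 3; congr 1; omega
  have hden : (den a b).eval t = ∏ k ∈ Ico (a 3) (b 3), (t + k) := eval_block _ _ _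
  have hpf := pf_den (b 3 - a 3 - 1).toNat (a 3) t (by rw [← hIco]; exact ht)
  rw [← hIco] at hpf
  have hR : R a b t = (R1 a b).eval t * (((b 3 - a 3 - 1).toNat.factorial : ℚ) / ∏ k ∈ Ico (a 3) (b 3), (t + k)) := by
    unfold R Pi facZ
    rw [hden, num_eq_numFac_mul_R1, eval_mul, eval_C]
    field_simp [numFac_ne_zero a b]
  rw [hR, hpf, mul_sum, polyP, eval_finsetSum, ← sum_add_distrib]
  refine sum_congr rfl fun k hk => ?_
  have hk0 : t + k ≠ 0 := ht k hk
  rw [eval_mul, eval_C, coefC, eps]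
  have e := eval_eq_dq (R1 a b) k t
  field_simp
  rw [e]; ring

/-- `R₁(−k) = 0` for `a₄ ≤ k < a₄*`, balance-free (proof = `R1_eval_neg_eq_zero`). -/
theorem R1_eval_neg_eq_zero_w (h : AdmissibleW a b) {k : ℤ} (hk : a 3 ≤ k) (hk' : k < amax a) :
    (R1 a b).eval (-(k : ℚ)) = 0 := by
  unfold R1 num
  rw [eval_mul]
  refine mul_eq_zero_of_right _ ?_
  have hz : ∀ j : Fin 4, j ≠ 3 → k < a j → (block (b j) (a j)).eval (-(k : ℚ)) = 0 := fun j hj hkj =>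
    (eval_block_eq_zero_iff _ _ _).2 ⟨k, mem_Ico.2 ⟨(h.lower j hj 3).trans hk, hkj⟩, rfl⟩
  simp only [eval_mul]
  unfold amax at hk'
  rcases lt_max_iff.1 hk' with h01 | h23
  · rcases lt_max_iff.1 h01 with h0 | h1
    · rw [hz 0 (by decide) h0]; ring
    · rw [hz 1 (by decide) h1]; ring
  · rcases lt_max_iff.1 h23 with h2 | h3
    · rw [hz 2 (by decide) h2]; ring
    · exact absurd h3 (not_lt.2 hk)

/-- Eq. (P1) on the printed range `a₄* ≤ k < b₄`, balance-free (proof = `R_eq_polyP_add_polar`). -/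
theorem R_eq_polyP_add_polar_w (h : AdmissibleW a b) {t : ℚ} (ht : ∀ k ∈ Ico (a 3) (b 3), t + k ≠ 0) :
    R a b t = (polyP a b).eval t + ∑ k ∈ Ico (amax a) (b 3), coefC a b k / (t + k) := by
  rw [R_eq_polyP_add_polar_full_w h ht]
  congr 1
  have hsub : Ico (amax a) (b 3) ⊆ Ico (a 3) (b 3) := Ico_subset_Ico (le_amax a 3) le_rfl
  symm
  refine sum_subset hsub fun k hk hk' => ?_
  have hk1 := mem_Ico.1 hk
  have hlt : k < amax a := by
    by_contra hc; exact hk' (mem_Ico.2 ⟨not_lt.1 hc, hk1.2⟩)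
  rw [coefC, R1_eval_neg_eq_zero_w h hk1.1 hlt, mul_zero, zero_div]

/-- Eq. (P1) as an identity in `ℚ[X]`, balance-free (proof = `Pi_mul_num_eq`). -/
theorem Pi_mul_num_eq_w (h : AdmissibleW a b) :
    C (Pi a b) * num a b = polyP a b * den a b + ∑ k ∈ Ico (a 3) (b 3), C (coefC a b k) * denErase a b k := by
  apply Polynomial.eq_of_infinite_eval_eq
  have hfin : (((Ico (a 3) (b 3)).image fun k : ℤ => -(k : ℚ)) : Set ℚ).Finite := Finset.finite_toSet _
  refine (hfin.infinite_compl).mono fun t ht => ?_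
  have ht' : ∀ k ∈ Ico (a 3) (b 3), t + k ≠ 0 := by
    intro k hk hzero
    exact ht (by
      rw [Finset.mem_coe, mem_image]
      exact ⟨k, hk, by linarith⟩)
  have hden : (den a b).eval t ≠ 0 := by
    unfold den
    exact eval_block_ne_zero fun i hi hti => ht' i hi (by rw [hti]; ring)
  have hR := R_eq_polyP_add_polar_full_w h ht'
  unfold R at hR
  rw [div_eq_iff hden] at hR
  simp only [Set.mem_setOf_eq, eval_mul, eval_C, eval_add, eval_finsetSum]
  rw [hR, add_mul, sum_mul]
  congr 1
  refine sum_congr rfl fun k hk => ?_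
  rw [den_eq_mul_denErase hk, eval_mul, eval_add, eval_X, eval_C]
  field_simp [ht' k hk]

/-- **`deg P ≤ d⁺`** balance-free (proof = `natDegree_polyP_le`; for `d < 0` the right side is `0` and `P = 0`). -/
theorem natDegree_polyP_le_w (h : AdmissibleW a b) : (polyP a b).natDegree ≤ dExp a b := by
  by_cases hP : polyP a b = 0
  · rw [hP, natDegree_zero]; exact Nat.zero_le _
  have hid := Pi_mul_num_eq_w h
  have hdeg : (polyP a b * den a b).natDegree = (polyP a b).natDegree + (b 3 - a 3).toNat := by
    rw [natDegree_mul hP (monic_den a b).ne_zero]; unfold den; rw [natDegree_block]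
  have hPd : polyP a b * den a b = C (Pi a b) * num a b - ∑ k ∈ Ico (a 3) (b 3), C (coefC a b k) * denErase a b k := by
    rw [hid]; ring
  have h1 : (C (Pi a b) * num a b).natDegree ≤ (a 0 - b 0).toNat + (a 1 - b 1).toNat + (a 2 - b 2).toNat :=
    (natDegree_C_mul_le _ _).trans (natDegree_num a b).le
  have h2 : (∑ k ∈ Ico (a 3) (b 3), C (coefC a b k) * denErase a b k).natDegree ≤ (b 3 - a 3).toNat - 1 :=
    natDegree_sum_le_of_forall_le _ _ fun k hk => (natDegree_C_mul_le _ _).trans (natDegree_denErase_le hk)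
  have h3 := (natDegree_sub_le _ _).trans (max_le_max h1 h2)
  rw [← hPd, hdeg] at h3
  have hu := h.upper 3
  have l0 := h.lower 0 (by decide) 0
  have l1 := h.lower 1 (by decide) 1
  have l2 := h.lower 2 (by decide) 2
  unfold dExp
  simp only [Fin.sum_univ_four]
  omega

end Summit.KontsevichZagierPeriods.Zeta5Search.TwoTaleOmega

namespace Summit.KontsevichZagierPeriods.Zeta5Search.FormalBarnes

open Summit.KontsevichZagierPeriods.Zeta5Search.TwoTaleOmega

/-- The first-tale data evaluate to `R` under weak admissibility (cf. `dataR_eval`). -/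
theorem dataR_eval_w {a b : Fin 4 → ℤ} (h : AdmissibleW a b) {t : ℚ} (ht : ∀ k ∈ Ico (a 3) (b 3), t + k ≠ 0) :
    (dataR a b).eval t = R a b t := by
  rw [R_eq_polyP_add_polar_w h ht]
  unfold PF.eval dataR
  simp only
  rw [sum_singles (fun _ => by simp) (fun _ _ _ => by ring), Finsupp.sum_zero_index, add_zero]

/-! ### Order statistics of four integers, in linear form -/

/-- Lower bounds for the second smallest `a₂*`: it dominates the minimum of any three of the four entries. -/
theorem a2star_ge_min3 (v : Fin 4 → ℤ) :
    min (v 1) (min (v 2) (v 3)) ≤ a2star v ∧ min (v 0) (min (v 2) (v 3)) ≤ a2star v ∧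
    min (v 0) (min (v 1) (v 3)) ≤ a2star v ∧ min (v 0) (min (v 1) (v 2)) ≤ a2star v := by
  have key : ∀ i : Fin 4, ∀ L : ℤ, (∀ j : Fin 4, j ≠ i → L ≤ v j) → L ≤ a2star v := by
    intro i L hL
    have h1 : L ≤ minOthers v i := Finset.le_inf' _ _ fun j hj => hL j (Finset.mem_erase.1 hj).1
    exact h1.trans (Finset.le_sup' (minOthers v) (Finset.mem_univ i))
  refine ⟨key 0 _ ?_, key 1 _ ?_, key 2 _ ?_, key 3 _ ?_⟩ <;> intro j hj <;> fin_cases j <;> simp at hj ⊢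

/-- Upper bounds for `a₂*`: if one entry lies strictly below it, the other three dominate it (`a2star_le_of_lt`). -/
theorem a2star_le_others (v : Fin 4 → ℤ) (i : Fin 4) (h : v i < a2star v) : ∀ j : Fin 4, j ≠ i → a2star v ≤ v j :=
  fun _ hj => a2star_le_of_lt h hj


/-! ### Equality of data from Lemma U; closed-form data and the residue criterion -/

/-- Two data with the same three components are equal. -/
theorem PF.ext3 {v w : PF} (h1 : v.poly = w.poly) (h2 : v.simple = w.simple) (h3 : v.double = w.double) :
    v = w := by
  cases v; cases w; simp only at h1 h2 h3; subst h1; subst h2; subst h3; rfl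

/-- **Lemma U as an equality of data**: same values off a finite set containing both pole sets ⇒ same data. -/
theorem PF.eq_of_eval_eq_on (v w : PF) (S : Finset ℤ) (hv : v.poles ⊆ S) (hw : w.poles ⊆ S)
    (h : ∀ t : ℚ, (∀ k ∈ S, t + k ≠ 0) → v.eval t = w.eval t) : v = w := by
  obtain ⟨h1, h2, h3⟩ := PF.eq_of_eval_eq v w S (v.simple_support_subset_poles.trans hv)
    (v.double_support_subset_poles.trans hv) (w.simple_support_subset_poles.trans hw)
    (w.double_support_subset_poles.trans hw) h
  exact PF.ext3 h1 h2 h3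

/-- The poles of the closed-form data `ofFrac N S m` lie in `S`. -/
theorem PF.poles_ofFrac (S : Finset ℤ) (m : ℤ → ℕ) (N : ℚ[X]) : (PF.ofFrac S m N).poles ⊆ S :=
  union_subset (PF.ofFrac_simple_support S m N) (PF.ofFrac_double_support S m N)

/-- Exact division by a monic divisor. -/
theorem mul_divByMonic_of_dvd {P Q : ℚ[X]} (hQ : Q.Monic) (h : Q ∣ P) : Q * (P /ₘ Q) = P := by
  have e := modByMonic_add_div P Q
  rwa [(modByMonic_eq_zero_iff_dvd hQ).2 h, zero_add] at e

/-- `lin c` is monic. -/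
theorem monic_lin (c : ℤ) : (lin c).Monic := monic_X_add_C _

/-- **Residue criterion for closed-form data**: if `c ∉ S` and `(X+c)² ∣ N` then `ρ⁰_{−c}(N/D_{S,m}) = 0`
(the quotient data are again closed-form: `ofFrac (N /ₘ (X+c)²) S m`). -/
theorem PF.rho0_ofFrac_eq_zero (S : Finset ℤ) (m : ℤ → ℕ) (N : ℚ[X]) (hm : ∀ k ∈ S, m k = 1 ∨ m k = 2) {c : ℤ}
    (hc : c ∉ S) (hdvd : lin c ^ 2 ∣ N) : rho0 (-c) (PF.ofFrac S m N) = 0 := by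
  refine (PF.rho0_eq_zero_of_sq_mul _ (PF.ofFrac S m (N /ₘ lin c ^ 2)) c S (PF.poles_ofFrac S m N)
    (PF.poles_ofFrac S m _) hc fun t ht => ?_).1
  have htS : ∀ k ∈ S, t + k ≠ 0 := fun k hk => ht k (mem_insert_of_mem hk)
  rw [PF.eval_ofFrac S m N hm htS, PF.eval_ofFrac S m _ hm htS]
  conv_lhs => rw [← mul_divByMonic_of_dvd ((monic_lin c).pow 2) hdvd]
  rw [Polynomial.eval_mul, Polynomial.eval_pow, eval_lin, mul_div_assoc]

/-- The `ζ(2)`-residue of closed-form data vanishes off `S`. -/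
theorem PF.rho1_ofFrac_eq_zero (S : Finset ℤ) (m : ℤ → ℕ) (N : ℚ[X]) {c : ℤ} (hc : c ∉ S) :
    rho1 (-c) (PF.ofFrac S m N) = 0 := by
  unfold rho1; rw [neg_neg, PF.ofFrac_simple_eq_zero S m N hc, mul_zero]

/-- Closed-form data vanish (as a function) at a non-pole integer `M` where the numerator vanishes. -/
theorem PF.eval_ofFrac_eq_zero_of_dvd (S : Finset ℤ) (m : ℤ → ℕ) (N : ℚ[X]) (hm : ∀ k ∈ S, m k = 1 ∨ m k = 2)
    {M : ℤ} (hM : -M ∉ S) (hdvd : lin (-M) ∣ N) : (PF.ofFrac S m N).eval (M : ℚ) = 0 := by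
  have ht : ∀ k ∈ S, (M : ℚ) + k ≠ 0 := fun k hk h => hM (by
    have : k = -M := by exact_mod_cast (by linarith : (k : ℚ) = -M)
    exact this ▸ hk)
  rw [PF.eval_ofFrac S m N hm ht]
  obtain ⟨Q, hQ⟩ := hdvd
  rw [hQ, Polynomial.eval_mul, eval_lin]; push_cast; ring

/-- The double part of closed-form data vanishes off `S` (second-tale `ζ(2)`-residue). -/
theorem altRes1_ofFrac_eq_zero (S : Finset ℤ) (m : ℤ → ℕ) (N : ℚ[X]) {M : ℤ} (hM : -M ∉ S) :
    altRes1 M (PF.ofFrac S m N) = 0 := by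
  unfold altRes1; rw [PF.ofFrac_double_eq_zero S m N (fun h => hM h.1), mul_zero]

/-! ### Blocks and linear factors -/

/-- `(X + c) ∣ block lo hi` when `lo ≤ c < hi`. -/
theorem lin_dvd_block {lo hi c : ℤ} (h1 : lo ≤ c) (h2 : c < hi) : lin c ∣ block lo hi :=
  Finset.dvd_prod_of_mem _ (mem_Ico.2 ⟨h1, h2⟩)

/-- A block of length one is a linear factor. -/
theorem block_single (lo : ℤ) : block lo (lo + 1) = lin lo := by
  have : Ico lo (lo + 1) = {lo} := by ext i; simp only [mem_Ico, mem_singleton]; omega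
  unfold block lin; rw [this, prod_singleton]

/-- Peeling the lowest factor off a block. -/
theorem block_succ_left {lo hi : ℤ} (h : lo < hi) : block lo hi = lin lo * block (lo + 1) hi := by
  rw [← block_single, block_mul_block (by omega) (by omega)]

/-- The constant-multiplicity-one denominator over a range is the block: `D_{[lo,hi),1} = block lo hi`. -/
theorem denom_Ico_one (lo hi : ℤ) : denom (Ico lo hi) (fun _ => 1) = block lo hi := by
  rw [denom_eq]; unfold block; simp only [pow_one]

end Summit.KontsevichZagierPeriods.Zeta5Search.FormalBarnes

namespace Summit.KontsevichZagierPeriods.Zeta5Search.TwoTaleOmega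

/-! ### The field assembly of a telescoping identity -/

/-- **Assembly.** From the cleared certificate identity (the shape of `Certificates.TwoTaleTelescope*.telescope_<d>_<X>`)
and the Γ-ratio facts `F_k·den_k = σ_k·num_k·F₀` (`k = 0..3`), `F₀'·td = F₀·tn` (where `F₀' = F₀(t+1)`), with all cleared
denominators non-zero: `Σ_k c_k F_k = (cnumS·x₁/cdenS)·F₀' − (cnum·x₀/cden)·F₀`. -/
theorem telescope_assembly {F0 F0' F1 F2 F3 n1 n2 n3 d1 d2 d3 s1 s2 s3 c0 c1 c2 c3
    tn td cnum cnumS cden cdenS x0 x1 : ℚ}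
    (hF1 : F1 * d1 = s1 * n1 * F0) (hF2 : F2 * d2 = s2 * n2 * F0) (hF3 : F3 * d3 = s3 * n3 * F0)
    (hS : F0' * td = F0 * tn)
    (hd1 : d1 ≠ 0) (hd2 : d2 ≠ 0) (hd3 : d3 ≠ 0) (htd : td ≠ 0) (hcden : cden ≠ 0) (hcdenS : cdenS ≠ 0)
    (hA : (c0 * d1 * d2 * d3 + s1 * c1 * n1 * d2 * d3 + s2 * c2 * n2 * d1 * d3 + s3 * c3 * n3 * d1 * d2)
        * cdenS * td * cden = (cnumS * x1 * tn * cden - cnum * x0 * cdenS * td) * (d1 * d2 * d3)) :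
    c0 * F0 + c1 * F1 + c2 * F2 + c3 * F3 = cnumS * x1 / cdenS * F0' - cnum * x0 / cden * F0 := by
  have e1 : F1 = s1 * n1 * F0 / d1 := by rw [← hF1, mul_div_cancel_right₀ _ hd1]
  have e2 : F2 = s2 * n2 * F0 / d2 := by rw [← hF2, mul_div_cancel_right₀ _ hd2]
  have e3 : F3 = s3 * n3 * F0 / d3 := by rw [← hF3, mul_div_cancel_right₀ _ hd3]
  have eS : F0' = F0 * tn / td := by rw [← hS, mul_div_cancel_right₀ _ htd]
  rw [eS, e1, e2, e3]
  field_simp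
  linear_combination F0 * hA

end Summit.KontsevichZagierPeriods.Zeta5Search.TwoTaleOmega

end
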